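import Mathlib
import HarnessLib
import Summits.Ventures.LatticeQCDFlow.Exactness.NCMCGeneralSpaceReplicaSumCLT
import Summits.Ventures.LatticeQCDFlow.Exactness.NCMCGeneralSpaceDoeblinPowerCLT
import Summits.Ventures.LatticeQCDFlow.Exactness.NCMCGeneralSpaceDoeblinPowerEveryStart
import Summits.Ventures.LatticeQCDFlow.Exactness.NCMCGeneralSpaceGammaMethodStudentizedCLT

/-!
# `R` independent replicas of a chain with a Doeblin power, POOLED: `√(R n) (x̄_{R,n} − π f) ⇒ N(0, σ²_f)` from EVERY family of initial laws, and the pooled mean obeys the strong law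

HONEST FRAMING: exact (Metropolis-corrected) sampling algorithms for lattice gauge theory;
figures of merit are autocorrelation/cost numbers at stated couplings and volumes; no
continuum-physics claim.

Venture `LatticeQCDFlow` (cell pub-lqcd), topic `Exactness`; FANOUT row 13 (`eng-snf`, GEN-23).
NEW WORK of the cell, not a published result; no definition is introduced; nothing is cited as a
fact (replica pooling of Monte Carlo time series — U. Wolff, *Monte Carlo errors with less errors*,
Comput. Phys. Commun. 156 (2004) 143, §3 — is NAMED ONLY).  GEN-19's central limit theorem under a
Doeblin POWER from every initial law (`tendstoInDistribution_timeAverage_of_nHit`,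
`NCMCGeneralSpaceDoeblinPowerCLT`) and its every-start strong law
(`tendsto_sum_div_anyLaw_of_nHit_minorised`, `NCMCGeneralSpaceDoeblinPowerEveryStart`) concern ONE
stream.  The engine runs `R` streams with independent seeds and their own (arbitrary, possibly cold or
hot) starts and POOLS the `R n` records.  With GEN-23's pooling lemma
(`tendstoInDistribution_pi_invSqrt_mul_sum`, `NCMCGeneralSpaceReplicaSumCLT`) the `R` one-stream
theorems, which live on `R` different path spaces, combine on the product law
`⊗_r P_{μ_r}` of the `R` chains: the pooled time average is asymptotically normal with the ONE-stream
Green–Kubo variance `σ²_f` at the pooled sample size `R n`, whatever the `R` initial laws — `R`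
replicas of length `n` are worth one equilibrium run of length `R n` to leading order (row 8's
`Scoring/ReplicaChains.lean` prices the finite-`n` burn-in bias this hides: it keeps weight `1 − 1/R`).

## Content (`κ` Markov on `S`, `π` invariant, `(nHit κ m)(z, ·) ≥ ε ν` for all `z`, `ε ≠ 0`,
## `0 < m`; `|f| ≤ C` measurable; `σ²_f = C_f̄(0) + 2 Σ_{t≥1} C_f̄(t)` in the `Scoring.autocov` form of
## GEN-20; `ι` a finite non-empty replica index, `R = card ι`; `μ : ι → Measure S` ANY family of initial
## laws; the replica law is `Measure.pi (r ↦ P_{μ r})`, `P_{μ r}` row 8's chain law from `μ r`)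

* `invSqrt_mul_sum_invSqrt_mul_eq`, `invSqrt_mul_sum_sub_eq_sqrt_mul` — the normalisations
  `(√R)⁻¹ Σ_r (√n)⁻¹ Σ_t = (√(Rn))⁻¹ Σ_r Σ_t` and `(√(Rn))⁻¹ Σ_r Σ_t (a − c) = √(Rn) (ā_{R,n} − c)`.
* **`tendstoInDistribution_pooledSum_of_nHit`** — for every `Y` with law `N(0, σ²_f)`:
  `(√(R n))⁻¹ Σ_r Σ_{t<n} (f(x^r_t) − πf) ⇒ Y` under the replica law, EVERY family `μ`.
* **`tendstoInDistribution_sqrt_mul_pooledMean_sub_of_nHit`** — the same as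
  `√(R n) (x̄_{R,n} − πf) ⇒ Y`, `x̄_{R,n} = (Σ_r Σ_{t<n} f(x^r_t))/(R n)` the POOLED mean.
* **`tendsto_pooledMean_ae_of_nHit_minorised`** — for every `π`-integrable measurable `φ`:
  `x̄_{R,n}(φ) → ∫ φ dπ` almost surely under the replica law, EVERY family `μ`.
* `…_of_minorised` forms (`m = 1`, the one-step certificate of rows 8 / 9's samplers).

NOT CLAIMED: dependent replicas (e.g. replicas branched off one stream); unequal replica lengths;
a consistent estimator of `σ²_f` from the pooled records (see
`NCMCGeneralSpaceReplicaPooledGammaCoverage`); the finite-`n` bias; anything numerical.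
-/

namespace Summit.Ventures.LatticeQCDFlow.Exactness.GeneralNCMC

open MeasureTheory ProbabilityTheory Set Filter Finset
open scoped ENNReal NNReal Topology

variable {S : Type*} [MeasurableSpace S]

/-! ## §1 The two normalisations -/

section Algebra

variable {ι : Type*} [Fintype ι]

/-- `(√R)⁻¹ Σ_r ((√n)⁻¹ Σ_{t<n} a r t) = (√(R n))⁻¹ Σ_r Σ_{t<n} a r t`. -/
theorem invSqrt_mul_sum_invSqrt_mul_eq (a : ι → ℕ → ℝ) (n : ℕ) :
    (Real.sqrt (Fintype.card ι))⁻¹ * ∑ r, ((Real.sqrt n)⁻¹ * ∑ t ∈ range n, a r t)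
      = (Real.sqrt ((Fintype.card ι : ℝ) * n))⁻¹ * ∑ r, ∑ t ∈ range n, a r t := by
  rw [Real.sqrt_mul (Nat.cast_nonneg _), mul_inv, ← Finset.mul_sum, mul_assoc]

/-- `(√(R n))⁻¹ Σ_r Σ_{t<n} (a r t − c) = √(R n) · ((Σ_r Σ_{t<n} a r t)/(R n) − c)`. -/
theorem invSqrt_mul_sum_sub_eq_sqrt_mul [Nonempty ι] (a : ι → ℕ → ℝ) (c : ℝ) (n : ℕ) :
    (Real.sqrt ((Fintype.card ι : ℝ) * n))⁻¹ * ∑ r, ∑ t ∈ range n, (a r t - c)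
      = Real.sqrt ((Fintype.card ι : ℝ) * n)
        * ((∑ r, ∑ t ∈ range n, a r t) / ((Fintype.card ι : ℝ) * n) - c) := by
  rcases Nat.eq_zero_or_pos n with hn | hn
  · subst hn
    simp
  · have hR : 0 < (Fintype.card ι : ℝ) := by exact_mod_cast Fintype.card_pos
    have hM : 0 < (Fintype.card ι : ℝ) * n := by positivity
    set M : ℝ := (Fintype.card ι : ℝ) * n with hMdef
    have hsum : ∑ r, ∑ t ∈ range n, (a r t - c) = (∑ r, ∑ t ∈ range n, a r t) - M * c := by
      simp only [Finset.sum_sub_distrib, Finset.sum_const, Finset.card_range, Finset.card_univ,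
        nsmul_eq_mul, hMdef]
      ring
    rw [hsum]
    have hM0 : M ≠ 0 := hM.ne'
    calc (Real.sqrt M)⁻¹ * ((∑ r, ∑ t ∈ range n, a r t) - M * c)
        = (Real.sqrt M / M) * ((∑ r, ∑ t ∈ range n, a r t) - M * c) := by rw [Real.sqrt_div_self]
      _ = Real.sqrt M * (((∑ r, ∑ t ∈ range n, a r t) - M * c) / M) := by ring
      _ = Real.sqrt M * ((∑ r, ∑ t ∈ range n, a r t) / M - c) := by
          rw [sub_div, mul_div_cancel_left₀ c hM0]

end Algebra

/-! ## §2 The pooled central limit theorem -/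

section Pooled

variable {κ : Kernel S S} [IsMarkovKernel κ] {π : Measure S} [IsProbabilityMeasure π]
  {ν : Measure S} [IsProbabilityMeasure ν] {ε : ℝ≥0∞} {m : ℕ}
  {ι : Type*} [Fintype ι] [Nonempty ι]

/-- **One replica, against the canonical Gaussian variable**: GEN-19's CLT from the initial law `μ₀`
with the variance written in GEN-20's `Scoring.autocov` form and the limit `id` on
`(ℝ, gaussianReal 0 σ²_f)`. -/
theorem tendstoInDistribution_timeAverage_id_of_nHit (hπ : Kernel.Invariant κ π) (hε : ε ≠ 0)
    (hmin : ∀ z, ε • ν ≤ nHit κ m z) (hm : 0 < m)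
    {f : S → ℝ} (hf : Measurable f) {C : ℝ} (hC : ∀ x, |f x| ≤ C)
    (μ₀ : Measure S) [IsProbabilityMeasure μ₀]
    [IsProbabilityMeasure (Kernel.trajMeasure (X := fun _ : ℕ => S) μ₀
        (fun n : ℕ => κ.comap (fun hh : (i : ↥(Finset.Iic n)) → S => hh ⟨n, Finset.mem_Iic.2 le_rfl⟩)
          (measurable_pi_apply _)))] :
    TendstoInDistribution (fun (n : ℕ) (x : ℕ → S) =>
        (Real.sqrt n)⁻¹ * ∑ t ∈ range n, (f (x t) - ∫ z, f z ∂π))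
      atTop id (fun _ => Kernel.trajMeasure (X := fun _ : ℕ => S) μ₀
        (fun n : ℕ => κ.comap (fun hh : (i : ↥(Finset.Iic n)) → S => hh ⟨n, Finset.mem_Iic.2 le_rfl⟩)
          (measurable_pi_apply _)))
      (gaussianReal 0 (Real.toNNReal (Scoring.autocov κ π (fun y => f y - ∫ z, f z ∂π) 0
        + 2 * ∑' t, Scoring.autocov κ π (fun y => f y - ∫ z, f z ∂π) (t + 1)))) := by
  have h := tendstoInDistribution_timeAverage_of_nHit hπ hε hmin hm hf hC μ₀
    (P' := gaussianReal 0 (Real.toNNReal ((∫ y, (f y - ∫ z, f z ∂π) ^ 2 ∂π)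
      + 2 * ∑' k, ∫ y, (f y - ∫ z, f z ∂π)
        * (Scoring.kop κ)^[k + 1] (fun y => f y - ∫ z, f z ∂π) y ∂π))) (Y := id) HasLaw.id
  rw [cltVariance_eq_autocov κ π f] at h
  exact h

/-- **THE POOLED CLT, FROM EVERY FAMILY OF INITIAL LAWS.**  `κ` Markov, `π` invariant,
`(nHit κ m)(z, ·) ≥ ε ν` (`ε ≠ 0`, `0 < m`), `|f| ≤ C` measurable; `R = card ι ≥ 1` INDEPENDENT
replicas, replica `r` started from `μ r` (ANY probability laws).  For every real random variable `Y`
with law `N(0, σ²_f)`: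
`(√(R n))⁻¹ Σ_r Σ_{t<n} (f(x^r_t) − πf) ⇒ Y` under the replica law `⊗_r P_{μ r}`. -/
theorem tendstoInDistribution_pooledSum_of_nHit (hπ : Kernel.Invariant κ π) (hε : ε ≠ 0)
    (hmin : ∀ z, ε • ν ≤ nHit κ m z) (hm : 0 < m)
    {f : S → ℝ} (hf : Measurable f) {C : ℝ} (hC : ∀ x, |f x| ≤ C)
    (μ : ι → Measure S) [∀ r, IsProbabilityMeasure (μ r)]
    {Ω' : Type*} [MeasurableSpace Ω'] {P' : Measure Ω'} [IsProbabilityMeasure P'] {Y : Ω' → ℝ}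
    (hY : HasLaw Y (gaussianReal 0 (Real.toNNReal (Scoring.autocov κ π (fun y => f y - ∫ z, f z ∂π) 0
        + 2 * ∑' t, Scoring.autocov κ π (fun y => f y - ∫ z, f z ∂π) (t + 1)))) P')
    [∀ r, IsProbabilityMeasure (Kernel.trajMeasure (X := fun _ : ℕ => S) (μ r)
        (fun n : ℕ => κ.comap (fun hh : (i : ↥(Finset.Iic n)) → S => hh ⟨n, Finset.mem_Iic.2 le_rfl⟩)
          (measurable_pi_apply _)))] :
    TendstoInDistribution (fun (n : ℕ) (x : ι → ℕ → S) =>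
        (Real.sqrt ((Fintype.card ι : ℝ) * n))⁻¹ * ∑ r, ∑ t ∈ range n, (f (x r t) - ∫ z, f z ∂π))
      atTop Y (fun _ => Measure.pi fun r => Kernel.trajMeasure (X := fun _ : ℕ => S) (μ r)
        (fun n : ℕ => κ.comap (fun hh : (i : ↥(Finset.Iic n)) → S => hh ⟨n, Finset.mem_Iic.2 le_rfl⟩)
          (measurable_pi_apply _))) P' := by
  have hX : ∀ (_r : ι) (n : ℕ), Measurable fun x : ℕ → S =>
      (Real.sqrt n)⁻¹ * ∑ t ∈ range n, (f (x t) - ∫ z, f z ∂π) := fun _ n =>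
    measurable_const.mul (Finset.measurable_sum _ fun t _ =>
      ((hf.comp (measurable_pi_apply t)).sub measurable_const))
  have h1 := fun r => tendstoInDistribution_timeAverage_id_of_nHit hπ hε hmin hm hf hC (μ r)
  have h2 := tendstoInDistribution_pi_invSqrt_mul_sum
    (P := fun r => Kernel.trajMeasure (X := fun _ : ℕ => S) (μ r)
      (fun n : ℕ => κ.comap (fun hh : (i : ↥(Finset.Iic n)) → S => hh ⟨n, Finset.mem_Iic.2 le_rfl⟩)
        (measurable_pi_apply _)))
    (X := fun (_r : ι) (n : ℕ) (x : ℕ → S) => (Real.sqrt n)⁻¹ * ∑ t ∈ range n, (f (x t) - ∫ z, f z ∂π))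
    hX h1 hY
  refine h2.congr (fun n => Eventually.of_forall fun x => ?_) Filter.EventuallyEq.rfl
  exact invSqrt_mul_sum_invSqrt_mul_eq (fun r t => f (x r t) - ∫ z, f z ∂π) n

/-- **THE POOLED MEAN IS ASYMPTOTICALLY NORMAL AT THE POOLED SAMPLE SIZE**: with
`x̄_{R,n} = (Σ_r Σ_{t<n} f(x^r_t))/(R n)`, `√(R n) (x̄_{R,n} − πf) ⇒ N(0, σ²_f)` under the replica law,
from EVERY family of initial laws. -/
theorem tendstoInDistribution_sqrt_mul_pooledMean_sub_of_nHit (hπ : Kernel.Invariant κ π)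
    (hε : ε ≠ 0) (hmin : ∀ z, ε • ν ≤ nHit κ m z) (hm : 0 < m)
    {f : S → ℝ} (hf : Measurable f) {C : ℝ} (hC : ∀ x, |f x| ≤ C)
    (μ : ι → Measure S) [∀ r, IsProbabilityMeasure (μ r)]
    {Ω' : Type*} [MeasurableSpace Ω'] {P' : Measure Ω'} [IsProbabilityMeasure P'] {Y : Ω' → ℝ}
    (hY : HasLaw Y (gaussianReal 0 (Real.toNNReal (Scoring.autocov κ π (fun y => f y - ∫ z, f z ∂π) 0
        + 2 * ∑' t, Scoring.autocov κ π (fun y => f y - ∫ z, f z ∂π) (t + 1)))) P')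
    [∀ r, IsProbabilityMeasure (Kernel.trajMeasure (X := fun _ : ℕ => S) (μ r)
        (fun n : ℕ => κ.comap (fun hh : (i : ↥(Finset.Iic n)) → S => hh ⟨n, Finset.mem_Iic.2 le_rfl⟩)
          (measurable_pi_apply _)))] :
    TendstoInDistribution (fun (n : ℕ) (x : ι → ℕ → S) =>
        Real.sqrt ((Fintype.card ι : ℝ) * n)
          * ((∑ r, ∑ t ∈ range n, f (x r t)) / ((Fintype.card ι : ℝ) * n) - ∫ z, f z ∂π))
      atTop Y (fun _ => Measure.pi fun r => Kernel.trajMeasure (X := fun _ : ℕ => S) (μ r)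
        (fun n : ℕ => κ.comap (fun hh : (i : ↥(Finset.Iic n)) → S => hh ⟨n, Finset.mem_Iic.2 le_rfl⟩)
          (measurable_pi_apply _))) P' := by
  have h := tendstoInDistribution_pooledSum_of_nHit hπ hε hmin hm hf hC μ hY
  refine h.congr (fun n => Eventually.of_forall fun x => ?_) Filter.EventuallyEq.rfl
  exact invSqrt_mul_sum_sub_eq_sqrt_mul (fun r t => f (x r t)) (∫ z, f z ∂π) n

/-- **One-step minorisation** (`κ(z, ·) ≥ ε ν`, the certificate shape of rows 8 / 9's samplers):
`√(R n) (x̄_{R,n} − πf) ⇒ N(0, σ²_f)` under the replica law, every family of starts. -/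
theorem tendstoInDistribution_sqrt_mul_pooledMean_sub_of_minorised (hπ : Kernel.Invariant κ π)
    (hε : ε ≠ 0) (hmin : ∀ z, ε • ν ≤ κ z)
    {f : S → ℝ} (hf : Measurable f) {C : ℝ} (hC : ∀ x, |f x| ≤ C)
    (μ : ι → Measure S) [∀ r, IsProbabilityMeasure (μ r)]
    {Ω' : Type*} [MeasurableSpace Ω'] {P' : Measure Ω'} [IsProbabilityMeasure P'] {Y : Ω' → ℝ}
    (hY : HasLaw Y (gaussianReal 0 (Real.toNNReal (Scoring.autocov κ π (fun y => f y - ∫ z, f z ∂π) 0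
        + 2 * ∑' t, Scoring.autocov κ π (fun y => f y - ∫ z, f z ∂π) (t + 1)))) P')
    [∀ r, IsProbabilityMeasure (Kernel.trajMeasure (X := fun _ : ℕ => S) (μ r)
        (fun n : ℕ => κ.comap (fun hh : (i : ↥(Finset.Iic n)) → S => hh ⟨n, Finset.mem_Iic.2 le_rfl⟩)
          (measurable_pi_apply _)))] :
    TendstoInDistribution (fun (n : ℕ) (x : ι → ℕ → S) =>
        Real.sqrt ((Fintype.card ι : ℝ) * n)
          * ((∑ r, ∑ t ∈ range n, f (x r t)) / ((Fintype.card ι : ℝ) * n) - ∫ z, f z ∂π))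
      atTop Y (fun _ => Measure.pi fun r => Kernel.trajMeasure (X := fun _ : ℕ => S) (μ r)
        (fun n : ℕ => κ.comap (fun hh : (i : ↥(Finset.Iic n)) → S => hh ⟨n, Finset.mem_Iic.2 le_rfl⟩)
          (measurable_pi_apply _))) P' := by
  have hmin' : ∀ z, ε • ν ≤ nHit κ 1 z := fun z => by rw [nHit_one]; exact hmin z
  exact tendstoInDistribution_sqrt_mul_pooledMean_sub_of_nHit hπ hε hmin' Nat.one_pos hf hC μ hY

/-! ## §3 The pooled strong law from every family of initial laws -/

omit [Nonempty ι] in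
/-- **THE POOLED MEAN OBEYS THE STRONG LAW, EVERY FAMILY OF STARTS.**  `κ` Markov, `π` invariant,
`(nHit κ m)(z, ·) ≥ ε ν` (`ε ≠ 0`); `φ` measurable and `π`-integrable; replicas started from ANY laws
`μ r`.  Almost surely under the replica law, `(Σ_r Σ_{i<n} φ(x^r_i))/(R n) → ∫ φ dπ`. -/
theorem tendsto_pooledMean_ae_of_nHit_minorised [Nonempty ι] (hπ : Kernel.Invariant κ π) (hε : ε ≠ 0)
    (hmin : ∀ z, ε • ν ≤ nHit κ m z) {φ : S → ℝ} (hφm : Measurable φ) (hφ : Integrable φ π)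
    (μ : ι → Measure S) [∀ r, IsProbabilityMeasure (μ r)]
    [∀ r, IsProbabilityMeasure (Kernel.trajMeasure (X := fun _ : ℕ => S) (μ r)
        (fun n : ℕ => κ.comap (fun hh : (i : ↥(Finset.Iic n)) → S => hh ⟨n, Finset.mem_Iic.2 le_rfl⟩)
          (measurable_pi_apply _)))] :
    ∀ᵐ x ∂(Measure.pi fun r => Kernel.trajMeasure (X := fun _ : ℕ => S) (μ r)
        (fun n : ℕ => κ.comap (fun hh : (i : ↥(Finset.Iic n)) → S => hh ⟨n, Finset.mem_Iic.2 le_rfl⟩)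
          (measurable_pi_apply _))),
      Tendsto (fun n : ℕ => (∑ r, ∑ i ∈ range n, φ (x r i)) / ((Fintype.card ι : ℝ) * n)) atTop
        (𝓝 (∫ a, φ a ∂π)) := by
  have hR : (Fintype.card ι : ℝ) ≠ 0 := by exact_mod_cast (Fintype.card_ne_zero : Fintype.card ι ≠ 0)
  -- every replica obeys GEN-19's strong law from its own start; transfer to the product
  have hr : ∀ r : ι, ∀ᵐ x ∂(Measure.pi fun r => Kernel.trajMeasure (X := fun _ : ℕ => S) (μ r)
      (fun n : ℕ => κ.comap (fun hh : (i : ↥(Finset.Iic n)) → S => hh ⟨n, Finset.mem_Iic.2 le_rfl⟩)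
        (measurable_pi_apply _))),
      Tendsto (fun n : ℕ => (∑ i ∈ range n, φ (x r i)) / n) atTop (𝓝 (∫ a, φ a ∂π)) := fun r =>
    ae_pi_eval_of_ae (P := fun r => Kernel.trajMeasure (X := fun _ : ℕ => S) (μ r)
      (fun n : ℕ => κ.comap (fun hh : (i : ↥(Finset.Iic n)) → S => hh ⟨n, Finset.mem_Iic.2 le_rfl⟩)
        (measurable_pi_apply _))) r
      (tendsto_sum_div_anyLaw_of_nHit_minorised hπ hε hmin hφm hφ (μ r))
  have hall := ae_all_iff.2 hr
  filter_upwards [hall] with x hx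
  -- the pooled mean is the replica average of the one-stream means
  have heq : ∀ n : ℕ, (∑ r, ∑ i ∈ range n, φ (x r i)) / ((Fintype.card ι : ℝ) * n)
      = (∑ r, (∑ i ∈ range n, φ (x r i)) / n) / Fintype.card ι := by
    intro n
    rw [← Finset.sum_div, div_div, mul_comm]
  simp_rw [heq]
  have hlim : (∑ _r : ι, ∫ a, φ a ∂π) / Fintype.card ι = ∫ a, φ a ∂π := by
    rw [Finset.sum_const, Finset.card_univ, nsmul_eq_mul]
    field_simp
  rw [← hlim]
  exact (tendsto_finsetSum _ fun r _ => hx r).div_const _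

end Pooled

end Summit.Ventures.LatticeQCDFlow.Exactness.GeneralNCMC
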